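import Literature.MathematicalPhysics.QuantumFieldTheory.Balaban1983to89.B11Eq90V0primeCurrent

/-!
# `Balaban1983to89.B11Eq90Transpose` — T. Bałaban, *The variational problem and background fields in renormalization group method for lattice gauge theories*, Commun. Math. Phys. **102** (1985) 277–309 [Balaban1985Variational]: (63) p. 287, (27) p. 282, (85)–(90) p. 291 — THE TRANSPOSITION `𝔇*(A′)H*` OF (85)–(90) ON THE CARRIERS OF (115): the (27)-transpose `Mᵗ` of an operator `M` of the space (115) acting on `|·|_{(−3)}`-currents (`⟨MᵗK, δ⟩ = ⟨K, Mδ⟩`), its `|·|_{(−3)}` operator norm through the weighted column norm of the kernel (print's kernel route (46)/(73) → (86)), the mechanism (with the sequel `B11Eq90Pullback`) by which every group of `(δ/δA′)V` in (85)–(90) is «composed with (47)»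

statement-level skeleton of published theorems with citation tags; proofs where landed; nothing here is a claim about the Yang–Mills mass gap

PDF held: `paper:balaban1985-cmp102-variational-background` (journal page = PDF page + 276); pp. 282, 285–293 read from the `lit read` text
layer by this seat (2026-08-21); displays as transcribed in `B11Eq27Current` ((27)), `B11Eq63FunctionalDerivative` ((63)), `B11Eq85FirstDerivative`
((85)–(90)), `B11Eq115Space` ((115)).

CITATION HEADER (lean-in-tree rule 2026-08-18).  WHAT IS REPRODUCED: the common MECHANISM of the five termwise groups (85)–(96) of
`W = (δ/δA′)V` (rows `B11.Eq85`/`B11.Prop4` of reader r08's `ROWS-B11.md`; `B11Prop4Assembly.TermwiseDatum`): each group is a (63)-current READ AT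
`A = A′ − HD(A′)` and TRANSPORTED BACK TO `A′` by the transpose of the derivative of the Sect. C map (47) — print's factor `𝔇*(A′)H*`
(`𝔇(A′) = (δ/δA′)D(A′)` of (63), `H` of (45)); pub-balaban NE9 letter (L3) `W : Space115 … → NegSize … 3 V` (INTERFACE REQUEST NE9 (L3), HOME/INBOX.md
l.13889: «`W := (δ/δA′)V` as an OBJECT `Space115 L η lev₀ lev₁ (nabla115 η U₀) → NegSize L η lev₀ 3 𝔸`»; W-slot of the owner's
`NE9CurChartOfBackground.cur_chart_exists_of_W_H126`).  THE PRINT, verbatim.  p. 287 (63): *«⟨(δ/δA′)D(A′), δA′⟩ = (d/dτ)D(A′ + τδA′)|_{τ=0}. Let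
us denote the kernel by 𝔇(A′; c, b), c ∈ 𝔅ₖ, b ⊂ Ω₀.»*; p. 291 (85)–(86): *«For the first term we have (δ/δA′(b))⟨HD₃(A′), J⟩ = Σ_{b′,c}
𝔇₃(A′; c, b)H(b′, c)J(b′) (85) and from the bound (73) it follows that |…| ≤ Σ_j Σ_{y∈Λ_j} Σ_{b′∈B_j(y)} (Lʲη)^d |J(b′)||H(b′, c)||𝔇₃(A′; c, b)| ≤ …
≤ O(1)ε₁ε₃²(Lʲη)⁻³ (86) We have gathered together all the constants into an absolute constant O(1).»*; (88): *«… the functional derivative is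
equal to Δ_π HD(A′) + 𝔇*(A′)H*Δ_π A′ = …»*; (89): *«The functional derivative of the third term in V(A′) is equal to 𝔇*(A′)H*Δ_π HD(A′)»*; (90):
*«(δ/δA′(b))V′₀(A′ − HD(A′)) = Σ_{p∈st(b)}((∂/∂A(b))V′₀)(A′ − HD(A′), ∂p) − 𝔇*(A′)H*Σ_{p∈st(·)}((∂/∂A(·))V′₀)(A′ − HD(A′), ∂p)»*; p. 282
(27): *«… = ⟨A, J⟩»* (the pairing `⟨A, J⟩ = Σ_b η^d tr A(b)J(b)`, `B9Eq39Adjoint.bondPair`).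

WHAT IS DEFINED AND PROVED (sorry-free; axioms `propext`/`Classical.choice`/`Quot.sound`; defs with bodies; no `Prop`-valued definition, no new
named fact; finite-dimensional fibre `𝔸 ⊇ 𝔤ᶜ` where operators are transposed — print: `𝔤ᶜ ⊆ M_N(ℂ)`).
§1 **`pair27 τ K δ`** — the pairing (27) of a `|·|_{(−3)}`-current `K` with a direction `δ` (= `bondPair … (curL K) (curL δ)` under this lineage's
   torus bridge, `pair27_def`; `pair27_eq_sum`: `= η^d Σ_b τ(K(b)δ(b))`); bilinearity (`pair27_add/smul/neg/sub_left`, `_add/smul/sum_right`); `pair27_single`; **`eq_of_pair27_eq`** — for a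
   non-degenerate trace pairing a current IS DETERMINED by its pairings: the (63)-certificates of the lineage identify their objects UNIQUELY.
§2 `single115 b : 𝔸 →L[ℂ] Space115 …` (the coordinate `A′(b)`), `sum_single115` (`Y = Σ_b δ_b Y(b)`).
§3 `kernel M b′ b : 𝔸 →L[ℂ] 𝔸` (the matrix kernel `X ↦ (Mδ_bX)(b′)` — print's `H(b, c)`, `𝔇(A′; c, b)`), `colFun`, **`transCur ρ τ M :
   NegSize … 3 𝔸 →L[ℂ] NegSize … 3 𝔸`** — `(MᵗK)(b) = ρ(X ↦ Σ_{b′} τ(K(b′)(Mδ_bX)(b′)))` with `ρ` the ℂ-LINEAR dualising map of the bilinear trace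
   pairing (`τ(ρ(ℓ)X) = ℓ X`; constructed from the cell's fibre convention in `B11Eq98V0primeCurrentSlots.rieszτ`) — and **`pair27_transCur`:
   `⟨MᵗK, δ⟩ = ⟨K, Mδ⟩`** (`pair27_transCur'`: the same with the direction a configuration of (115); `transCur_id`: `1ᵗ = 1`).
§4 `opNorm_colFun_le`, **`norm_transCur_le`**: `‖MᵗK‖₍₋₃₎ ≤ ‖ρ‖‖τ‖·Θ·‖K‖₍₋₃₎` whenever `Σ_{b′}((Lʲ⁽ᵇ⁾η)³/(Lʲ⁽ᵇ′⁾η)³)‖k_M(b′, b)‖ ≤ Θ` for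
   every bond `b` — the WEIGHTED COLUMN NORM of the kernel, i.e. exactly the quantity print bounds in (86) from the kernel estimates (46), (73).
§5 `colFun_add/_smul`, `transCurL` (the transposition `M ↦ Mᵗ` as a continuous linear map; finite dimension).
(The PULLBACK `(Φ′(A′))ᵗ cur(Φ A′)` of a current along a map and its chain-rule certificate are the sequel `B11Eq90Pullback`.)

HONEST SCOPE — what is NOT claimed.  (i) A MECHANISM file: [folklore] finite-dimensional linear algebra (transpose of a matrix of operators with
respect to a trace pairing); NOTHING of Bałaban's estimates is asserted — the column letter `Θ` is where print's kernel bounds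
(46), (73) enter, DISPLAYED by consumers; no uniformity in the lattice is claimed here.  (ii) `ρ`, `τ` letters with the dualising display
`τ(ρ(ℓ)X) = ℓ X` (hypothesis of `pair27_transCur`).  (iii) The sequels `B11Eq90Pullback` / `B11Eq90V0GroupComposed` type the pullback and
instantiate it at (47) and this lineage's V₀-current; the groups (85), (88), (89) need the letters `J`, `Δ_π` at the carrier and are NOT typed here.  (iv) NOT summit progress
(cell pub-balaban: NE9 NOT PRINTED / NOT PROVED; «NE9 ⇐ the named binders»; spine PROVED 0/9; HONEST DEPENDENCY: continuum YM on T⁴ ⇐ BetaPertH ∧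
nine spine estimates (0/9 proved); BetaPertH ⇐ (D1) ∧ (D4) ∧ CAP+tail; G-an2-4 gates asym, D1 and NE2/3/4).  Unit `b2b-balaban-t4-ne9-formalise-leaf-05`
(NE9 crux-team leaf prover, gen 65).  Imports `B11Eq90V0primeCurrent` (this lineage) ONLY; modifies nothing.
-/

noncomputable section

open NormedSpace Complex Metric Set Finset Filter Topology

namespace Literature.MathematicalPhysics.QuantumFieldTheory.Balaban1983to89.B11Eq90Transpose

open Literature.MathematicalPhysics.QuantumFieldTheory.Balaban1983to89.B9Eq39Adjoint (bondPair)
open Literature.MathematicalPhysics.QuantumFieldTheory.Balaban1983to89.B11Eq90V0primeCurrent (curL curL_apply flat115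
  flat115_apply)
open Literature.MathematicalPhysics.QuantumFieldTheory.Balaban1983to89.B11Eq90V0Derivative (deriv_line_eq_fderiv)
open B9SectCLatticeCarrier (Bond)
open B4Sect5Torus (TSite)
open B11Eq115Space

variable {𝔸 : Type*} [NormedRing 𝔸] [NormedAlgebra ℂ 𝔸]
variable {d : ℕ} {Pd : Fin d → ℕ} {L η : ℝ} {lev₀ : Bond d Pd → ℕ} {κ' : Type*} {lev₁ : κ' → ℕ}
  {Dc : (Bond d Pd → 𝔸) →ₗ[ℂ] (κ' → 𝔸)}

/-! ## §1 The pairing (27) between a `|·|_{(−3)}`-current and a direction -/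

/-- **The pairing (27)** `⟨K, δ⟩ = η^d Σ_b tr K(b)δ(b)` between a current `K` of the `|·|_{(−3)}`-carrier and a direction `δ` (a bond
function), in r08's letters (`B9Eq39Adjoint.bondPair` under the identification `curL`): the left member of every (63)-certificate of this
lineage. [cite: Balaban1985Variational, (27) p.282, (63) p.287] -/
def pair27 (τ : 𝔸 →L[ℂ] ℂ) (K : NegSize L η lev₀ 3 𝔸) (δ : Bond d Pd → 𝔸) : ℂ :=
  bondPair η d (τ : 𝔸 →ₗ[ℂ] ℂ) (curL (NegSup.equiv (levWeight L η lev₀ 3) 𝔸 K)) (curL δ)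

/-- Unfolding: `pair27` IS `bondPair … (curL K) (curL δ)`. [cite: Balaban1985Variational, (27) p.282] -/
theorem pair27_def (τ : 𝔸 →L[ℂ] ℂ) (K : NegSize L η lev₀ 3 𝔸) (δ : Bond d Pd → 𝔸) :
    pair27 τ K δ = bondPair η d (τ : 𝔸 →ₗ[ℂ] ℂ) (curL (NegSup.equiv (levWeight L η lev₀ 3) 𝔸 K)) (curL δ) := rfl

/-- The pairing as a sum over bonds: `⟨K, δ⟩ = η^d Σ_b τ(K(b)δ(b))`. [cite: Balaban1985Variational, (27) p.282] -/
theorem pair27_eq_sum (τ : 𝔸 →L[ℂ] ℂ) (K : NegSize L η lev₀ 3 𝔸) (δ : Bond d Pd → 𝔸) :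
    pair27 τ K δ = (η : ℂ) ^ d * ∑ b : Bond d Pd, τ (NegSup.equiv (levWeight L η lev₀ 3) 𝔸 K b * δ b) := by
  rw [pair27_def, bondPair, Fintype.sum_prod_type]
  rfl

/-- The pairing is additive in the direction. [cite: Balaban1985Variational, (27) p.282] -/
theorem pair27_add_right (τ : 𝔸 →L[ℂ] ℂ) (K : NegSize L η lev₀ 3 𝔸) (δ₁ δ₂ : Bond d Pd → 𝔸) :
    pair27 τ K (δ₁ + δ₂) = pair27 τ K δ₁ + pair27 τ K δ₂ := by
  simp only [pair27_eq_sum, Pi.add_apply, mul_add, map_add, Finset.sum_add_distrib]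

/-- The pairing is homogeneous in the direction. [cite: Balaban1985Variational, (27) p.282] -/
theorem pair27_smul_right (τ : 𝔸 →L[ℂ] ℂ) (K : NegSize L η lev₀ 3 𝔸) (c : ℂ) (δ : Bond d Pd → 𝔸) :
    pair27 τ K (c • δ) = c * pair27 τ K δ := by
  rw [pair27_eq_sum, pair27_eq_sum, Finset.mul_sum, Finset.mul_sum, Finset.mul_sum]
  refine Finset.sum_congr rfl fun b _ => ?_
  rw [Pi.smul_apply, mul_smul_comm, map_smul, smul_eq_mul]
  ring

/-- The pairing is additive in the current. [cite: Balaban1985Variational, (27) p.282] -/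
theorem pair27_add_left (τ : 𝔸 →L[ℂ] ℂ) (K₁ K₂ : NegSize L η lev₀ 3 𝔸) (δ : Bond d Pd → 𝔸) :
    pair27 τ (K₁ + K₂) δ = pair27 τ K₁ δ + pair27 τ K₂ δ := by
  simp only [pair27_eq_sum, NegSup.equiv_add, Pi.add_apply, add_mul, map_add, Finset.sum_add_distrib, mul_add]

/-- The pairing is homogeneous in the current. [cite: Balaban1985Variational, (27) p.282] -/
theorem pair27_smul_left (τ : 𝔸 →L[ℂ] ℂ) (c : ℂ) (K : NegSize L η lev₀ 3 𝔸) (δ : Bond d Pd → 𝔸) :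
    pair27 τ (c • K) δ = c * pair27 τ K δ := by
  rw [pair27_eq_sum, pair27_eq_sum, Finset.mul_sum, Finset.mul_sum, Finset.mul_sum]
  refine Finset.sum_congr rfl fun b _ => ?_
  rw [NegSup.equiv_smul, Pi.smul_apply, smul_mul_assoc, map_smul, smul_eq_mul]
  ring

/-- The pairing is compatible with negation of the current. [cite: Balaban1985Variational, (27) p.282] -/
theorem pair27_neg_left (τ : 𝔸 →L[ℂ] ℂ) (K : NegSize L η lev₀ 3 𝔸) (δ : Bond d Pd → 𝔸) :
    pair27 τ (-K) δ = -pair27 τ K δ := by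
  rw [← neg_one_smul ℂ K, pair27_smul_left, neg_one_mul]

/-- The pairing is compatible with subtraction of currents. [cite: Balaban1985Variational, (27) p.282] -/
theorem pair27_sub_left (τ : 𝔸 →L[ℂ] ℂ) (K₁ K₂ : NegSize L η lev₀ 3 𝔸) (δ : Bond d Pd → 𝔸) :
    pair27 τ (K₁ - K₂) δ = pair27 τ K₁ δ - pair27 τ K₂ δ := by
  rw [sub_eq_add_neg, pair27_add_left, pair27_neg_left, ← sub_eq_add_neg]

/-- The pairing with a sum of directions. [cite: Balaban1985Variational, (27) p.282] -/
theorem pair27_sum_right (τ : 𝔸 →L[ℂ] ℂ) (K : NegSize L η lev₀ 3 𝔸) {ι' : Type*} (s : Finset ι') (δ : ι' → Bond d Pd → 𝔸) :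
    pair27 τ K (∑ i ∈ s, δ i) = ∑ i ∈ s, pair27 τ K (δ i) := by
  classical
  induction s using Finset.induction_on with
  | empty => simp [pair27_eq_sum]
  | insert a s ha ih => rw [Finset.sum_insert ha, Finset.sum_insert ha, pair27_add_right, ih]

/-- The pairing against a one-bond direction: `⟨K, δ_b Y⟩ = η^d τ(K(b)Y)`. [cite: Balaban1985Variational, (27) p.282, (90) p.291] -/
theorem pair27_single (τ : 𝔸 →L[ℂ] ℂ) (K : NegSize L η lev₀ 3 𝔸) (b : Bond d Pd) (Y : 𝔸) :
    pair27 τ K (Pi.single b Y) = (η : ℂ) ^ d * τ (NegSup.equiv (levWeight L η lev₀ 3) 𝔸 K b * Y) := by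
  classical
  rw [pair27_eq_sum, Finset.sum_eq_single b]
  · rw [Pi.single_eq_same]
  · intro b' _ hb'; rw [Pi.single_eq_of_ne hb', mul_zero, map_zero]
  · intro h; exact absurd (Finset.mem_univ b) h

/-- **A current is determined by its pairings** (non-degenerate trace pairing, `η ≠ 0`): the (63)-certificates of this lineage identify
their currents UNIQUELY — print's «The functional derivative is a kernel of the linear operator acting on functions δA′ and defined as
⟨(δ/δA′)D(A′), δA′⟩ = (d/dτ)D(A′ + τδA′)|_{τ=0}». [cite: Balaban1985Variational, (63) p.287] -/
theorem eq_of_pair27_eq (τ : 𝔸 →L[ℂ] ℂ) (hτ : ∀ X : 𝔸, (∀ Y : 𝔸, τ (X * Y) = 0) → X = 0) (hη : η ≠ 0)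
    {K₁ K₂ : NegSize L η lev₀ 3 𝔸} (h : ∀ δ : Bond d Pd → 𝔸, pair27 τ K₁ δ = pair27 τ K₂ δ) : K₁ = K₂ := by
  apply (NegSup.equiv (levWeight L η lev₀ 3) 𝔸).injective
  funext b
  rw [← sub_eq_zero]
  refine hτ _ fun Y => ?_
  have hb := h (Pi.single b Y)
  rw [pair27_single, pair27_single, mul_right_inj' (pow_ne_zero _ (Complex.ofReal_ne_zero.2 hη))] at hb
  rw [sub_mul, map_sub, hb, sub_self]

/-! ## §2 The one-bond injection into the space (115) -/

section Single

variable [Fact (0 < L)] [Fact (0 < η)] [Fintype κ'] [FiniteDimensional ℂ 𝔸]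

/-- **The one-bond injection** `X ↦ δ_b X` into the space (115) (the configuration equal to `X` at the bond `b` and `0` elsewhere; print's
coordinate `A′(b)` of `δ/δA′(b)`), a continuous linear map (finite-dimensional fibre). [cite: Balaban1985Variational, (90) p.291, (115) p.294] -/
def single115 (b : Bond d Pd) : 𝔸 →L[ℂ] Space115 L η lev₀ lev₁ Dc :=
  LinearMap.toContinuousLinearMap
    { toFun := fun X => (JetSup.equiv (levWeight L η lev₀ 1) (levWeight L η lev₁ 2) Dc).symm (Pi.single b X)
      map_add' := fun X Y => by
        apply (JetSup.equiv (levWeight L η lev₀ 1) (levWeight L η lev₁ 2) Dc).injective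
        simp only [Equiv.apply_symm_apply, JetSup.equiv_add, Pi.single_add]
      map_smul' := fun c X => by
        apply (JetSup.equiv (levWeight L η lev₀ 1) (levWeight L η lev₁ 2) Dc).injective
        simp only [Equiv.apply_symm_apply, JetSup.equiv_smul, Pi.single_smul, RingHom.id_apply] }

/-- Unfolding: the bond function underlying `single115 b X` is `Pi.single b X`. [cite: Balaban1985Variational, (115) p.294] -/
@[simp] theorem flat115_single115 (b : Bond d Pd) (X : 𝔸) :
    flat115 (single115 (L := L) (η := η) (lev₀ := lev₀) (lev₁ := lev₁) (Dc := Dc) b X) = Pi.single b X := rfl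

/-- Every configuration of the space (115) is the sum of its one-bond pieces. [cite: Balaban1985Variational, (90) p.291] -/
theorem sum_single115 (Y : Space115 L η lev₀ lev₁ Dc) :
    ∑ b : Bond d Pd, single115 (lev₁ := lev₁) (Dc := Dc) b (flat115 Y b) = Y := by
  apply (JetSup.equiv (levWeight L η lev₀ 1) (levWeight L η lev₁ 2) Dc).injective
  have h : (JetSup.equiv (levWeight L η lev₀ 1) (levWeight L η lev₁ 2) Dc)
      (∑ b : Bond d Pd, single115 (lev₁ := lev₁) (Dc := Dc) b (flat115 Y b))
        = ∑ b : Bond d Pd, Pi.single b (flat115 Y b) := by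
    rw [← flat115_apply, map_sum]
    rfl
  rw [h, Finset.univ_sum_single]
  rfl

/-- A direction (bond function) read in the space (115) is the sum of its one-bond pieces. [cite: Balaban1985Variational, (90) p.291] -/
theorem sum_single115_symm (δ : Bond d Pd → 𝔸) :
    ∑ b : Bond d Pd, single115 (lev₁ := lev₁) (Dc := Dc) b (δ b)
      = (JetSup.equiv (levWeight L η lev₀ 1) (levWeight L η lev₁ 2) Dc).symm δ := by
  have h := sum_single115 (lev₁ := lev₁) (Dc := Dc) ((JetSup.equiv (levWeight L η lev₀ 1) (levWeight L η lev₁ 2) Dc).symm δ)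
  simpa only [flat115_apply, Equiv.apply_symm_apply] using h

end Single

/-! ## §3 The transpose `Mᵗ` of an operator on the space (115) with respect to the pairing (27): print's `𝔇*(A′)H*` -/

section Transpose

variable [Fact (0 < L)] [Fact (0 < η)] [Fintype κ'] [FiniteDimensional ℂ 𝔸]

/-- **The matrix kernel** `k_M(b′, b) : 𝔸 →L[ℂ] 𝔸` of an operator `M` on the space (115): `X ↦ (M δ_b X)(b′)` (print's kernels
`H(b, c)`, `𝔇(A′; c, b)` of (46), (63)–(73), (85)). [cite: Balaban1985Variational, (63) p.287, (85) p.291] -/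
def kernel (M : Space115 L η lev₀ lev₁ Dc →L[ℂ] Space115 L η lev₀ lev₁ Dc) (b' b : Bond d Pd) : 𝔸 →L[ℂ] 𝔸 :=
  (JetSup.evalCLM (levWeight L η lev₀ 1) (levWeight L η lev₁ 2) Dc b').comp (M.comp (single115 b))

/-- Unfolding the kernel. [cite: Balaban1985Variational, (63) p.287] -/
@[simp] theorem kernel_apply (M : Space115 L η lev₀ lev₁ Dc →L[ℂ] Space115 L η lev₀ lev₁ Dc) (b' b : Bond d Pd) (X : 𝔸) :
    kernel M b' b X = flat115 (M (single115 b X)) b' := rfl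

/-- **The one-bond functional of the transposed current**: `X ↦ Σ_{b′} τ(K(b′)·(M δ_b X)(b′))` (= `η^{−d}⟨K, M δ_b X⟩`).
[cite: Balaban1985Variational, (63) p.287, (90) p.291] -/
def colFun (τ : 𝔸 →L[ℂ] ℂ) (M : Space115 L η lev₀ lev₁ Dc →L[ℂ] Space115 L η lev₀ lev₁ Dc) (K : NegSize L η lev₀ 3 𝔸)
    (b : Bond d Pd) : 𝔸 →L[ℂ] ℂ :=
  ∑ b' : Bond d Pd, (τ.comp (ContinuousLinearMap.mul ℂ 𝔸 (NegSup.equiv (levWeight L η lev₀ 3) 𝔸 K b'))).comp (kernel M b' b)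

/-- Unfolding the one-bond functional. [cite: Balaban1985Variational, (63) p.287] -/
theorem colFun_apply (τ : 𝔸 →L[ℂ] ℂ) (M : Space115 L η lev₀ lev₁ Dc →L[ℂ] Space115 L η lev₀ lev₁ Dc) (K : NegSize L η lev₀ 3 𝔸)
    (b : Bond d Pd) (X : 𝔸) :
    colFun τ M K b X = ∑ b' : Bond d Pd, τ (NegSup.equiv (levWeight L η lev₀ 3) 𝔸 K b' * flat115 (M (single115 b X)) b') := by
  simp only [colFun, _root_.sum_apply, ContinuousLinearMap.comp_apply, kernel_apply,
    ContinuousLinearMap.mul_apply']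

/-- **THE TRANSPOSE OF AN OPERATOR ON THE SPACE (115) WITH RESPECT TO THE PAIRING (27)** — the mechanism behind print's `𝔇*(A′)H*` in
(85)–(90): for `M : Space115 → Space115` continuous linear, `Mᵗ : NegSize … 3 𝔸 →L[ℂ] NegSize … 3 𝔸`, `(MᵗK)(b) = ρ(X ↦ Σ_{b′} τ(K(b′)(Mδ_bX)(b′)))`
with `ρ` the dualising map of the bilinear trace pairing (`τ(ρ(ℓ)X) = ℓ X`, `B11Eq98V0primeCurrentSlots.rieszτ`); characterised by
`⟨MᵗK, δ⟩ = ⟨K, Mδ⟩` (`pair27_transCur`). [cite: Balaban1985Variational, (85) p.291, (88)–(90) p.291] -/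
def transCur (ρ : (𝔸 →L[ℂ] ℂ) →L[ℂ] 𝔸) (τ : 𝔸 →L[ℂ] ℂ) (M : Space115 L η lev₀ lev₁ Dc →L[ℂ] Space115 L η lev₀ lev₁ Dc) :
    NegSize L η lev₀ 3 𝔸 →L[ℂ] NegSize L η lev₀ 3 𝔸 :=
  LinearMap.toContinuousLinearMap
    { toFun := fun K => (NegSup.equiv (levWeight L η lev₀ 3) 𝔸).symm fun b => ρ (colFun τ M K b)
      map_add' := fun K₁ K₂ => by
        apply (NegSup.equiv (levWeight L η lev₀ 3) 𝔸).injective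
        funext b
        simp only [Equiv.apply_symm_apply, NegSup.equiv_add, Pi.add_apply, ← map_add]
        congr 1
        ext X
        simp only [colFun_apply, NegSup.equiv_add, Pi.add_apply, add_mul, map_add, Finset.sum_add_distrib,
          add_apply]
      map_smul' := fun c K => by
        apply (NegSup.equiv (levWeight L η lev₀ 3) 𝔸).injective
        funext b
        simp only [Equiv.apply_symm_apply, NegSup.equiv_smul, Pi.smul_apply, RingHom.id_apply, ← map_smul]
        congr 1
        ext X
        simp only [colFun_apply, NegSup.equiv_smul, Pi.smul_apply, smul_mul_assoc, map_smul, smul_eq_mul, Finset.mul_sum,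
          _root_.smul_apply] }

/-- Unfolding the transpose at a bond. [cite: Balaban1985Variational, (90) p.291] -/
theorem transCur_apply (ρ : (𝔸 →L[ℂ] ℂ) →L[ℂ] 𝔸) (τ : 𝔸 →L[ℂ] ℂ) (M : Space115 L η lev₀ lev₁ Dc →L[ℂ] Space115 L η lev₀ lev₁ Dc)
    (K : NegSize L η lev₀ 3 𝔸) (b : Bond d Pd) :
    NegSup.equiv (levWeight L η lev₀ 3) 𝔸 (transCur ρ τ M K) b = ρ (colFun τ M K b) := rfl

/-- **`⟨MᵗK, δ⟩ = ⟨K, Mδ⟩`** — the transpose IS the (27)-adjoint: for every current `K` and direction `δ`, given the dualising identity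
`τ(ρ(ℓ)X) = ℓ X`. (Proof: decompose `δ = Σ_b δ_b δ(b)` and use linearity of `M` and of the pairing.)
[cite: Balaban1985Variational, (85) p.291, (90) p.291, (27) p.282] -/
theorem pair27_transCur (ρ : (𝔸 →L[ℂ] ℂ) →L[ℂ] 𝔸) (τ : 𝔸 →L[ℂ] ℂ) (hρ : ∀ (ℓ : 𝔸 →L[ℂ] ℂ) (X : 𝔸), τ (ρ ℓ * X) = ℓ X)
    (M : Space115 L η lev₀ lev₁ Dc →L[ℂ] Space115 L η lev₀ lev₁ Dc) (K : NegSize L η lev₀ 3 𝔸) (δ : Bond d Pd → 𝔸) :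
    pair27 τ (transCur ρ τ M K) δ
      = pair27 τ K (flat115 (M ((JetSup.equiv (levWeight L η lev₀ 1) (levWeight L η lev₁ 2) Dc).symm δ))) := by
  rw [pair27_eq_sum, pair27_eq_sum]
  congr 1
  simp only [transCur_apply, hρ, colFun_apply]
  rw [Finset.sum_comm, ← sum_single115_symm (lev₁ := lev₁) (Dc := Dc) δ, map_sum, map_sum]
  refine Finset.sum_congr rfl fun b' _ => ?_
  rw [Finset.sum_apply, Finset.mul_sum, map_sum]

/-- `⟨MᵗK, δ⟩ = ⟨K, Mδ⟩` with the direction given as a configuration of the space (115). [cite: Balaban1985Variational, (85) p.291, (90) p.291] -/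
theorem pair27_transCur' (ρ : (𝔸 →L[ℂ] ℂ) →L[ℂ] 𝔸) (τ : 𝔸 →L[ℂ] ℂ) (hρ : ∀ (ℓ : 𝔸 →L[ℂ] ℂ) (X : 𝔸), τ (ρ ℓ * X) = ℓ X)
    (M : Space115 L η lev₀ lev₁ Dc →L[ℂ] Space115 L η lev₀ lev₁ Dc) (K : NegSize L η lev₀ 3 𝔸) (δ' : Space115 L η lev₀ lev₁ Dc) :
    pair27 τ (transCur ρ τ M K) (flat115 δ') = pair27 τ K (flat115 (M δ')) :=
  pair27_transCur ρ τ hρ M K (flat115 δ')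

/-- **SANITY: the transpose of the identity is the identity** (`ρ` dualising, trace pairing non-degenerate, `η ≠ 0`) — so for `Φ = id` (no
linearizing transformation, `H = 0`) the pullback of a current is the current itself. [cite: Balaban1985Variational, (90) p.291] -/
theorem transCur_id (ρ : (𝔸 →L[ℂ] ℂ) →L[ℂ] 𝔸) (τ : 𝔸 →L[ℂ] ℂ) (hρ : ∀ (ℓ : 𝔸 →L[ℂ] ℂ) (X : 𝔸), τ (ρ ℓ * X) = ℓ X)
    (hτ : ∀ X : 𝔸, (∀ Y : 𝔸, τ (X * Y) = 0) → X = 0) (hη : η ≠ 0) (K : NegSize L η lev₀ 3 𝔸) :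
    transCur ρ τ (ContinuousLinearMap.id ℂ (Space115 L η lev₀ lev₁ Dc)) K = K :=
  eq_of_pair27_eq τ hτ hη fun δ => by rw [pair27_transCur ρ τ hρ]; rfl

/-! ## §4 The `|·|_{(−3)}` operator norm of the transpose through the weighted column norm of the kernel -/

/-- The one-bond functional is bounded by the kernel column: `‖ℓ_b‖ ≤ Σ_{b′} ‖τ‖·‖K(b′)‖·‖k_M(b′, b)‖`.
[cite: Balaban1985Variational, (86) p.291] -/
theorem opNorm_colFun_le (τ : 𝔸 →L[ℂ] ℂ) (M : Space115 L η lev₀ lev₁ Dc →L[ℂ] Space115 L η lev₀ lev₁ Dc) (K : NegSize L η lev₀ 3 𝔸)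
    (b : Bond d Pd) :
    ‖colFun τ M K b‖ ≤ ∑ b' : Bond d Pd, ‖τ‖ * ‖NegSup.equiv (levWeight L η lev₀ 3) 𝔸 K b'‖ * ‖kernel M b' b‖ := by
  refine ContinuousLinearMap.opNorm_le_bound _ (Finset.sum_nonneg fun _ _ => by positivity) fun X => ?_
  rw [colFun_apply, Finset.sum_mul]
  refine (norm_sum_le _ _).trans (Finset.sum_le_sum fun b' _ => ?_)
  calc ‖τ (NegSup.equiv (levWeight L η lev₀ 3) 𝔸 K b' * flat115 (M (single115 b X)) b')‖
      ≤ ‖τ‖ * ‖NegSup.equiv (levWeight L η lev₀ 3) 𝔸 K b' * flat115 (M (single115 b X)) b'‖ := τ.le_opNorm _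
    _ ≤ ‖τ‖ * (‖NegSup.equiv (levWeight L η lev₀ 3) 𝔸 K b'‖ * ‖flat115 (M (single115 b X)) b'‖) := by
        gcongr; exact norm_mul_le _ _
    _ ≤ ‖τ‖ * (‖NegSup.equiv (levWeight L η lev₀ 3) 𝔸 K b'‖ * (‖kernel M b' b‖ * ‖X‖)) := by
        gcongr; rw [← kernel_apply]; exact (kernel M b' b).le_opNorm X
    _ = ‖τ‖ * ‖NegSup.equiv (levWeight L η lev₀ 3) 𝔸 K b'‖ * ‖kernel M b' b‖ * ‖X‖ := by ring

/-- **THE `|·|_{(−3)}`-NORM OF THE TRANSPOSE THROUGH THE WEIGHTED COLUMN NORM OF THE KERNEL** — print's route to (86)/(88)/(89): if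
`Σ_{b′} ((Lʲ⁽ᵇ⁾η)³/(Lʲ⁽ᵇ′⁾η)³)·‖k_M(b′, b)‖ ≤ Θ` for every bond `b` (the kernel bounds (46), (73) with their exponential decay give such a
`Θ` uniformly in the lattice), then `‖MᵗK‖₍₋₃₎ ≤ ‖ρ‖‖τ‖·Θ·‖K‖₍₋₃₎`. [cite: Balaban1985Variational, (86) p.291, (73) p.289, (46) p.285] -/
theorem norm_transCur_le (ρ : (𝔸 →L[ℂ] ℂ) →L[ℂ] 𝔸) (τ : 𝔸 →L[ℂ] ℂ) (M : Space115 L η lev₀ lev₁ Dc →L[ℂ] Space115 L η lev₀ lev₁ Dc)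
    {Θ : ℝ} (hΘ0 : 0 ≤ Θ)
    (hΘ : ∀ b : Bond d Pd, ∑ b' : Bond d Pd, levWeight L η lev₀ 3 b / levWeight L η lev₀ 3 b' * ‖kernel M b' b‖ ≤ Θ)
    (K : NegSize L η lev₀ 3 𝔸) : ‖transCur ρ τ M K‖ ≤ ‖ρ‖ * ‖τ‖ * Θ * ‖K‖ := by
  rw [NegSup.norm_le_iff (by positivity)]
  intro b
  have hw : ∀ b : Bond d Pd, 0 < levWeight L η lev₀ 3 b := levWeight_pos (Fact.out : 0 < L) (Fact.out : 0 < η) lev₀ 3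
  have hKb : ∀ b' : Bond d Pd, ‖NegSup.equiv (levWeight L η lev₀ 3) 𝔸 K b'‖ ≤ ‖K‖ / levWeight L η lev₀ 3 b' := fun b' => by
    rw [le_div_iff₀ (hw b'), mul_comm]; exact NegSup.weight_mul_norm_apply_le K b'
  rw [transCur_apply]
  calc levWeight L η lev₀ 3 b * ‖ρ (colFun τ M K b)‖
      ≤ levWeight L η lev₀ 3 b * (‖ρ‖ * ‖colFun τ M K b‖) := by gcongr; exacts [(hw b).le, ρ.le_opNorm _]
    _ ≤ levWeight L η lev₀ 3 b * (‖ρ‖ * ∑ b' : Bond d Pd, ‖τ‖ * ‖NegSup.equiv (levWeight L η lev₀ 3) 𝔸 K b'‖ * ‖kernel M b' b‖) := by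
        gcongr; exacts [(hw b).le, opNorm_colFun_le τ M K b]
    _ ≤ levWeight L η lev₀ 3 b * (‖ρ‖ * ∑ b' : Bond d Pd, ‖τ‖ * (‖K‖ / levWeight L η lev₀ 3 b') * ‖kernel M b' b‖) := by
        gcongr with b' _; exacts [(hw b).le, hKb b']
    _ = ‖ρ‖ * ‖τ‖ * (∑ b' : Bond d Pd, levWeight L η lev₀ 3 b / levWeight L η lev₀ 3 b' * ‖kernel M b' b‖) * ‖K‖ := by
        rw [Finset.mul_sum, Finset.mul_sum, Finset.mul_sum, Finset.sum_mul]
        refine Finset.sum_congr rfl fun b' _ => ?_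
        field_simp
    _ ≤ ‖ρ‖ * ‖τ‖ * Θ * ‖K‖ := by gcongr; exact hΘ b

/-! ## §5 The transpose is linear and continuous in the operator -/

/-- The one-bond functional is additive in the operator. [cite: Balaban1985Variational, (85) p.291] -/
theorem colFun_add (τ : 𝔸 →L[ℂ] ℂ) (M₁ M₂ : Space115 L η lev₀ lev₁ Dc →L[ℂ] Space115 L η lev₀ lev₁ Dc) (K : NegSize L η lev₀ 3 𝔸)
    (b : Bond d Pd) : colFun τ (M₁ + M₂) K b = colFun τ M₁ K b + colFun τ M₂ K b := by
  ext X
  simp only [colFun_apply, add_apply, map_add, Pi.add_apply, mul_add, Finset.sum_add_distrib]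

/-- The one-bond functional is homogeneous in the operator. [cite: Balaban1985Variational, (85) p.291] -/
theorem colFun_smul (τ : 𝔸 →L[ℂ] ℂ) (c : ℂ) (M : Space115 L η lev₀ lev₁ Dc →L[ℂ] Space115 L η lev₀ lev₁ Dc) (K : NegSize L η lev₀ 3 𝔸)
    (b : Bond d Pd) : colFun τ (c • M) K b = c • colFun τ M K b := by
  ext X
  simp only [colFun_apply, _root_.smul_apply, map_smul, Pi.smul_apply, mul_smul_comm, smul_eq_mul, Finset.mul_sum]

/-- **The transposition `M ↦ Mᵗ` as a continuous linear map** (finite-dimensional carriers) — used to differentiate `A′ ↦ (Φ′(A′))ᵗ(…)`.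
[cite: Balaban1985Variational, (85) p.291] -/
def transCurL (ρ : (𝔸 →L[ℂ] ℂ) →L[ℂ] 𝔸) (τ : 𝔸 →L[ℂ] ℂ) :
    (Space115 L η lev₀ lev₁ Dc →L[ℂ] Space115 L η lev₀ lev₁ Dc) →L[ℂ] (NegSize L η lev₀ 3 𝔸 →L[ℂ] NegSize L η lev₀ 3 𝔸) :=
  LinearMap.toContinuousLinearMap
    { toFun := transCur ρ τ
      map_add' := fun M₁ M₂ => by
        ext K : 1
        apply (NegSup.equiv (levWeight L η lev₀ 3) 𝔸).injective
        funext b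
        rw [add_apply, NegSup.equiv_add, Pi.add_apply, transCur_apply, transCur_apply, transCur_apply, colFun_add, map_add]
      map_smul' := fun c M => by
        ext K : 1
        apply (NegSup.equiv (levWeight L η lev₀ 3) 𝔸).injective
        funext b
        rw [RingHom.id_apply, _root_.smul_apply, NegSup.equiv_smul, Pi.smul_apply, transCur_apply, transCur_apply, colFun_smul,
          map_smul] }

/-- Unfolding `transCurL`. [cite: Balaban1985Variational, (85) p.291] -/
@[simp] theorem transCurL_apply (ρ : (𝔸 →L[ℂ] ℂ) →L[ℂ] 𝔸) (τ : 𝔸 →L[ℂ] ℂ)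
    (M : Space115 L η lev₀ lev₁ Dc →L[ℂ] Space115 L η lev₀ lev₁ Dc) : transCurL ρ τ M = transCur ρ τ M := rfl

end Transpose

end Literature.MathematicalPhysics.QuantumFieldTheory.Balaban1983to89.B11Eq90Transpose

end
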